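import Summits.BirchSwinnertonDyer.BirchSwinnertonDyer.Theorems.CyclotomicUntwistSecondKindRankTwo
import Mathlib.NumberTheory.Padics.Hensel
import HarnessLib

/-!
# Route `CyclotomicUntwist`: the unit-root splitting `log_W(Xᵖ) − (p/u)·log_W ∈ ℤ_p⟦X⟧` on an ORDINARY `V/ℤ_p`,
# Katz's rank (one) there, and the binder H3 for every good fibre

Cell `pub/bsd-wall` (D-0145 line `route-BirchSwinnertonDyer-CyclotomicUntwist`), prover seat `bsd-line-cycu-p3` (gen 8),
memo `KATZ-FROBENIUS-MOD-VARPI-v2`; beyond stub S2k: the ordinary-fibre half of the Literature named fact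
`katz_dieudonne_rank_le_two` (fact claim held by cycu-p5 g11, who lands `_holds`; this file only supplies theorems in
`…Theorems.SecondKindLog`). THEOREMS ONLY; `--supports` K1 = stmt-BirchSwinnertonDyer-21580. BSD is not proved by this
file and no crux is.

## The argument (general odd `p`; `T = expand p`, `ℓ = log_W`, `a = HasseManin.tr (V ⊗ 𝔽_p)`, `p ∤ a`)

* §1 `exists_unit_root`: Hensel gives `u ∈ ℤ_pˣ` with `u² − au + p = 0`; put `λ = a − u = p/u`, `‖λ‖ = ‖p‖`.
* §2 **`exists_isPadicInt_expand_formalLog_sub_smul` (UNIT-ROOT SPLITTING)**: `μ = Tℓ − λℓ ∈ ℤ_p⟦X⟧`. Indeed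
  `T²ℓ = aTℓ − pℓ + pS` with `S ∈ ℤ_p⟦X⟧` (Honda type of `log_W`, `CyclotomicUntwistSecondKindHondaRecursion`) gives
  `Tμ = uμ + pS` exactly, hence `Tⁿμ − uⁿμ ∈ ℤ_p⟦X⟧`; in degree `D < pⁿ` the coefficient of `Tⁿμ` vanishes, so
  `uⁿ·[X^D]μ ∈ ℤ_p` with `u` a unit.
* §3 `exists_sub_formalLog_bounded_of_ordinary` (**H3, ordinary**): every second-kind `f` has
  `p^{d''}(f − a'·ℓ) ∈ ℤ_p⟦X⟧` for some `a' ∈ ℚ_p` (rank one): STEP A/B and the digit expansion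
  (`CyclotomicUntwistSecondKindRankTwo.iterate_digits`) give `pᵏf ≡ Σ_{n<N} cₙTⁿℓ + Tᴺ(ℓ(G_N))`, and `Tⁿℓ ≡ λⁿℓ`.
* §4 `exists_sub_formalLog_sub_expand_bounded_all` (**H3 on every good fibre**) by cases with the supersingular theorem
  `exists_sub_formalLog_sub_expand_bounded`.

[cite: Katz1981CrystallineDieudonne, Thm. 5.3.3] [cite: Honda1970, Thm. 9] [cite: SilvermanAEC2009, IV.6.3, IV.7]
-/

set_option autoImplicit false
-- single-conjunct summit: `Summit.BirchSwinnertonDyer.BirchSwinnertonDyer.…` repeats the name by design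
set_option linter.dupNamespace false

noncomputable section

open PowerSeries Literature.NumberTheory.EllipticCurves
  Summit.BirchSwinnertonDyer.BirchSwinnertonDyer.Theorems.FormalLogDivisibility

namespace Summit.BirchSwinnertonDyer.BirchSwinnertonDyer.Theorems.SecondKindLog

variable {p : ℕ} [hp : Fact p.Prime]

/-! ## §1 The unit root of `X² − aX + p` -/

omit hp in
/-- `‖z‖ ≤ 1`-scalings of integral one-variable series are integral. [folklore] -/
theorem isPadicInt_smul_of_norm_le_one [Fact p.Prime] {z : ℚ_[p]} (hz : ‖z‖ ≤ 1) {Φ : ℚ_[p]⟦X⟧} (hΦ : IsPadicInt Φ) :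
    IsPadicInt (z • Φ) :=
  isPadicInt_iff_coeff.mpr fun n ↦ by
    rw [PowerSeries.coeff_smul, smul_eq_mul, norm_mul]
    exact mul_le_one₀ hz (norm_nonneg _) (isPadicInt_iff_coeff.mp hΦ n)

/-- **Hensel: the unit root.** If `p ∤ a` then `X² − aX + p` has a root `u ∈ ℤ_p` with `‖u‖ = 1`
(start Newton at `a`: `F(a) = p`, `F′(a) = a`). [folklore] -/
theorem exists_unit_root {a : ℤ} (ha : ¬ (p : ℤ) ∣ a) :
    ∃ u : ℤ_[p], ‖u‖ = 1 ∧ u * u - (a : ℤ_[p]) * u + p = 0 := by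
  set F : Polynomial ℤ := Polynomial.X ^ 2 - Polynomial.C a * Polynomial.X + Polynomial.C (p : ℤ) with hF
  have hFa : F.aeval (a : ℤ_[p]) = (p : ℤ_[p]) := by
    rw [hF]; simp; ring
  have hF' : F.derivative = 2 * Polynomial.X - Polynomial.C a := by
    rw [hF, Polynomial.derivative_add, Polynomial.derivative_sub, Polynomial.derivative_C_mul_X,
      Polynomial.derivative_X_pow, Polynomial.derivative_C]
    simp
  have hFda : F.derivative.aeval (a : ℤ_[p]) = (a : ℤ_[p]) := by
    rw [hF']
    simp only [map_sub, map_mul, map_ofNat, Polynomial.aeval_X, Polynomial.aeval_C, algebraMap_int_eq,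
      Int.coe_castRingHom]
    ring
  have hna : ‖(a : ℤ_[p])‖ = 1 := by
    rcases (PadicInt.norm_le_one (a : ℤ_[p])).lt_or_eq with h | h
    · exact absurd (PadicInt.norm_int_lt_one_iff_dvd a |>.mp h) ha
    · exact h
  have hnorm : ‖F.aeval (a : ℤ_[p])‖ < ‖F.derivative.aeval (a : ℤ_[p])‖ ^ 2 := by
    rw [hFa, hFda, hna, one_pow, PadicInt.norm_p]
    exact inv_lt_one_of_one_lt₀ (by exact_mod_cast hp.out.one_lt)
  obtain ⟨u, hu, hua, -, -⟩ := hensels_lemma hnorm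
  refine ⟨u, ?_, ?_⟩
  · rw [hFda, hna] at hua
    have h := IsUltrametricDist.norm_add_le_max (u - (a : ℤ_[p])) (a : ℤ_[p])
    rw [sub_add_cancel, hna] at h
    refine le_antisymm (PadicInt.norm_le_one u) ?_
    by_contra hlt
    rw [not_le] at hlt
    have : ‖(a : ℤ_[p])‖ < 1 := by
      have h2 := IsUltrametricDist.norm_add_le_max (-(u - (a : ℤ_[p]))) u
      rw [neg_sub, sub_add_cancel, norm_sub_rev] at h2
      rw [norm_sub_rev] at hua
      exact lt_of_le_of_lt h2 (max_lt (by rwa [norm_sub_rev]) hlt)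
    rw [hna] at this
    exact lt_irrefl _ this
  · have := hu
    rw [hF] at this
    simpa [sq] using this

/-! ## §2 The unit-root splitting on an ordinary fibre -/

section Ordinary

variable (V : WeierstrassCurve ℤ_[p]) [hE : (V.map PadicInt.Coe.ringHom).IsElliptic]
  [hEt : (V.map PadicInt.toZMod).IsElliptic]

/-- **UNIT-ROOT SPLITTING.** For `V/ℤ_p` (`p` odd, elliptic fibres) with ORDINARY special fibre (`p ∤ a`,
`a = HasseManin.tr (V ⊗ 𝔽_p)`) there is `λ ∈ ℚ_p`, `‖λ‖ ≤ ‖p‖` (`λ = p/u`, `u` the unit root of `X² − aX + p`), with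
**`log_W(Xᵖ) − λ·log_W ∈ ℤ_p⟦X⟧`** — on an ordinary fibre `φ[log_W] = λ[log_W]` holds INTEGRALLY. Proof: with `μ` the
left side, `Tμ = uμ + pS` (`S ∈ ℤ_p⟦X⟧` from the Honda type of `log_W`), so `Tⁿμ ≡ uⁿμ (mod ℤ_p⟦X⟧)`, and `[X^D]Tⁿμ = 0`
for `D < pⁿ`. [cite: Katz1981CrystallineDieudonne, Thm. 5.3.3] [cite: Honda1970, Thm. 9] -/
theorem exists_isPadicInt_expand_formalLog_sub_smul (hp2 : p ≠ 2)
    (hord : ¬ (p : ℤ) ∣ Literature.NumberTheory.EllipticCurves.HasseManin.tr (V.map PadicInt.toZMod)) :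
    ∃ lam : ℚ_[p], ‖lam‖ ≤ ‖(p : ℚ_[p])‖ ∧
      IsPadicInt (expand p hp.out.ne_zero (V.map PadicInt.Coe.ringHom).formalLog -
        lam • (V.map PadicInt.Coe.ringHom).formalLog) := by
  obtain ⟨S, hS, hS2⟩ := expand_sq_formalLog_eq V hp2
  set W := V.map PadicInt.Coe.ringHom with hWdef
  set a : ℤ := Literature.NumberTheory.EllipticCurves.HasseManin.tr (V.map PadicInt.toZMod) with hadef
  set T := expand p hp.out.ne_zero (R := ℚ_[p]) with hT
  obtain ⟨u, hu1, hu⟩ := exists_unit_root (p := p) hord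
  set uQ : ℚ_[p] := (u : ℚ_[p]) with huQ
  set lam : ℚ_[p] := (a : ℚ_[p]) - uQ with hlam
  have huQ1 : ‖uQ‖ = 1 := by rw [huQ, PadicInt.padic_norm_e_of_padicInt]; exact hu1
  have hulam : uQ * lam = p := by
    have h := congrArg (fun z : ℤ_[p] ↦ (z : ℚ_[p])) hu
    simp only [PadicInt.coe_add, PadicInt.coe_sub, PadicInt.coe_mul, PadicInt.coe_intCast, PadicInt.coe_natCast,
      PadicInt.coe_zero] at h
    rw [hlam, huQ]
    linear_combination -h
  have hlamn : ‖lam‖ = ‖(p : ℚ_[p])‖ := by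
    have := congrArg norm hulam
    rwa [norm_mul, huQ1, one_mul] at this
  refine ⟨lam, hlamn.le, ?_⟩
  set μ := T W.formalLog - lam • W.formalLog with hμ
  clear_value μ
  -- `Tμ = uμ + pS`
  have hTμ : T μ = uQ • μ + (p : ℚ_[p]) • S := by
    rw [hμ, map_sub, map_smul, ← AlgHom.mul_apply, ← pow_two, hS2, smul_sub, smul_smul, hulam,
      show ((a : ℤ) : ℚ_[p]) = uQ + lam by rw [hlam]; ring]
    module
  -- `Tⁿμ ≡ uⁿμ`
  have hpow : ∀ n : ℕ, IsPadicInt ((T ^ n) μ - (uQ ^ n) • μ) := by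
    intro n
    induction n with
    | zero => rw [pow_zero, pow_zero, AlgHom.one_apply, one_smul, sub_self]; exact IsPadicInt.zero
    | succ n ih =>
      have e : (T ^ (n + 1)) μ - (uQ ^ (n + 1)) • μ = T ((T ^ n) μ - (uQ ^ n) • μ) + (uQ ^ n * p) • S := by
        rw [pow_succ', AlgHom.mul_apply, map_sub, map_smul, hTμ, smul_add, smul_smul, smul_smul, pow_succ]
        module
      rw [e]
      have h := isPadicInt_expand_pow ih 1
      rw [pow_one] at h
      refine h.add (isPadicInt_smul_of_norm_le_one ?_ hS)
      rw [norm_mul, norm_pow, huQ1, one_pow, one_mul]; exact (Padic.norm_p_lt_one (p := p)).le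
  -- coefficients
  have hμ0 : constantCoeff μ = 0 := by
    rw [hμ, map_sub, hT, PowerSeries.constantCoeff_expand, W.constantCoeff_formalLog]
    simp
  refine isPadicInt_iff_coeff.mpr fun D ↦ ?_
  have hD : D < p ^ D := Nat.lt_pow_self hp.out.one_lt
  have h1 : coeff D ((T ^ D) μ - (uQ ^ D) • μ) = -(uQ ^ D * coeff D μ) := by
    rw [map_sub, coeff_expand_pow_eq_zero hμ0 hD, PowerSeries.coeff_smul, smul_eq_mul, zero_sub]
  have h2 := isPadicInt_iff_coeff.mp (hpow D) D
  rw [h1, norm_neg, norm_mul, norm_pow, huQ1, one_pow, one_mul] at h2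
  exact h2

/-! ## §3 H3 on an ordinary fibre (rank one) -/

/-- **Digit sums against a geometric eigenvalue**: if `Eₙ ≡ λⁿ·ℓ (mod ℤ_p⟦X⟧)` then
`Σ_{n<N} cₙEₙ ≡ (Σ cₙλⁿ)·ℓ`. [folklore] -/
theorem isPadicInt_digitSum_geom (c : ℕ → ℕ) {lam : ℚ_[p]} {ℓ : ℚ_[p]⟦X⟧} {E : ℕ → ℚ_[p]⟦X⟧}
    (hε : ∀ n, IsPadicInt (E n - (lam ^ n) • ℓ)) (N : ℕ) :
    IsPadicInt (∑ n ∈ Finset.range N, (c n : ℚ_[p]) • E n - (∑ n ∈ Finset.range N, (c n : ℚ_[p]) * lam ^ n) • ℓ) := by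
  induction N with
  | zero => simp only [Finset.sum_range_zero, zero_smul, sub_zero]; exact IsPadicInt.zero
  | succ N ih =>
    have h : IsPadicInt (((c N : ℤ) : ℚ_[p]) • (E N - (lam ^ N) • ℓ)) := isPadicInt_intCast_smul (c N : ℤ) (hε N)
    rw [Int.cast_natCast] at h
    have e : ∑ n ∈ Finset.range (N + 1), (c n : ℚ_[p]) • E n - (∑ n ∈ Finset.range (N + 1), (c n : ℚ_[p]) * lam ^ n) • ℓ =
        (∑ n ∈ Finset.range N, (c n : ℚ_[p]) • E n - (∑ n ∈ Finset.range N, (c n : ℚ_[p]) * lam ^ n) • ℓ) +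
        (c N : ℚ_[p]) • (E N - (lam ^ N) • ℓ) := by
      rw [Finset.sum_range_succ, Finset.sum_range_succ]
      module
    rw [e]
    exact ih.add h

/-- **H3 ON AN ORDINARY FIBRE (rank one).** For `V/ℤ_p` (`p` odd, elliptic fibres, `p ∤ a`) and every `f ∈ Xℚ_p⟦X⟧` whose
`F_W`-coboundary has bounded denominators there are `a' ∈ ℚ_p` and `d''` with **`p^{d''}·(f − a'·log_W) ∈ ℤ_p⟦X⟧`**.
Proof: `pᵏf = log_W(ψ)` (STEP A), `ψ̄ ∈ End(F̄)` (STEP B), digit expansion `pᵏf ≡ Σ cₙ Tⁿlog_W + Tᴺ(…)`, and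
`Tⁿlog_W ≡ λⁿlog_W` by the unit-root splitting. [cite: Katz1981CrystallineDieudonne, Thm. 5.3.3] -/
theorem exists_sub_formalLog_bounded_of_ordinary (hp2 : p ≠ 2)
    (hord : ¬ (p : ℤ) ∣ Literature.NumberTheory.EllipticCurves.HasseManin.tr (V.map PadicInt.toZMod))
    (f : ℚ_[p]⟦X⟧) (hf0 : constantCoeff f = 0)
    (hSK : ∃ d : ℕ, ∀ e, ‖(p : ℚ_[p]) ^ d * MvPowerSeries.coeff e
      (f.subst (V.map PadicInt.Coe.ringHom).formalGroupLaw - f.subst (MvPowerSeries.X 0 : MvPowerSeries (Fin 2) ℚ_[p]) -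
        f.subst (MvPowerSeries.X 1 : MvPowerSeries (Fin 2) ℚ_[p]))‖ ≤ 1) :
    ∃ (a' : ℚ_[p]) (d'' : ℕ), ∀ n, ‖(p : ℚ_[p]) ^ d'' *
      coeff n (f - C a' * (V.map PadicInt.Coe.ringHom).formalLog)‖ ≤ 1 := by
  obtain ⟨d, hd⟩ := hSK
  obtain ⟨lam, hlamn, hμ⟩ := exists_isPadicInt_expand_formalLog_sub_smul V hp2 hord
  set W := V.map PadicInt.Coe.ringHom with hWdef
  set T := expand p hp.out.ne_zero (R := ℚ_[p]) with hT
  haveI : W.IsIntegral ℤ_[p] := V.isIntegral_map_coe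
  have hp0 : (p : ℚ_[p]) ≠ 0 := by exact_mod_cast hp.out.ne_zero
  have hlam1 : ‖lam‖ ≤ 1 := hlamn.trans (Padic.norm_p_lt_one (p := p)).le
  -- STEP A / STEP B
  obtain ⟨k, ψ, hψint, hψ0, hℓψ⟩ := exists_isPadicInt_formalLog_subst_eq V hf0 hd hp2
  obtain ⟨G₀, hG₀⟩ := isPadicInt_iff_exists_powerSeries_map.mp hψint
  have hG₀0 : constantCoeff G₀ = 0 := by
    have h1 : (PadicInt.Coe.ringHom (p := p)) (constantCoeff G₀) = 0 := by
      rw [← coeff_zero_eq_constantCoeff_apply, ← coeff_map, hG₀, coeff_zero_eq_constantCoeff_apply, hψ0]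
    exact Subtype.ext h1
  have hcob : IsPadicInt (MvPowerSeries.C ((p : ℚ_[p]) ^ d) *
      (PowerSeries.subst W.formalGroupLaw (W.formalLog.subst (G₀.map PadicInt.Coe.ringHom)) -
        PowerSeries.subst (MvPowerSeries.X 0 : MvPowerSeries (Fin 2) ℚ_[p]) (W.formalLog.subst (G₀.map PadicInt.Coe.ringHom)) -
        PowerSeries.subst (MvPowerSeries.X 1 : MvPowerSeries (Fin 2) ℚ_[p]) (W.formalLog.subst (G₀.map PadicInt.Coe.ringHom)))) := by
    rw [hG₀, hℓψ, ← smul_eq_C_mul, PowerSeries.subst_smul W.hasSubst_formalGroupLaw,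
      PowerSeries.subst_smul (PowerSeries.HasSubst.X _), PowerSeries.subst_smul (PowerSeries.HasSubst.X _), ← smul_sub,
      ← smul_sub]
    intro e
    rw [MvPowerSeries.coeff_C_mul, MvPowerSeries.coeff_smul, mul_left_comm, norm_mul, norm_pow]
    exact mul_le_one₀ (pow_le_one₀ (norm_nonneg _) (Padic.norm_p_lt_one (p := p)).le) (norm_nonneg _) (hd e)
  have hEnd₀ := isHom_map_toZMod_of_cob V G₀ hG₀0 hp2 hcob
  obtain ⟨c, Gs, -, hGs0, hmain⟩ := iterate_digits V hp2 G₀ hG₀0 hEnd₀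
  -- `Tⁿℓ ≡ λⁿℓ`
  have hε : ∀ n, IsPadicInt ((T ^ n) W.formalLog - (lam ^ n) • W.formalLog) := by
    intro n
    induction n with
    | zero => rw [pow_zero, pow_zero, AlgHom.one_apply, one_smul, sub_self]; exact IsPadicInt.zero
    | succ n ih =>
      have e : (T ^ (n + 1)) W.formalLog - (lam ^ (n + 1)) • W.formalLog =
          T ((T ^ n) W.formalLog - (lam ^ n) • W.formalLog) + (lam ^ n) • (T W.formalLog - lam • W.formalLog) := by
        rw [pow_succ', AlgHom.mul_apply, map_sub, map_smul, smul_sub, smul_smul, pow_succ]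
        abel
      rw [e]
      refine (?_ : IsPadicInt _).add (isPadicInt_smul_of_norm_le_one ?_ hμ)
      · have h := isPadicInt_expand_pow ih 1
        rwa [pow_one] at h
      · rw [norm_pow]; exact pow_le_one₀ (norm_nonneg _) hlam1
  -- the limit of the digit sums
  set r : ℝ := ‖(p : ℚ_[p])‖ with hr
  have hr0 : 0 ≤ r := norm_nonneg _
  have hr1 : r < 1 := Padic.norm_p_lt_one
  obtain ⟨aI, ha⟩ := exists_limit_of_norm_sub_succ_le
    (u := fun N ↦ ∑ n ∈ Finset.range N, (c n : ℚ_[p]) * lam ^ n) hr0 hr1 (fun N ↦ by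
      rw [Finset.sum_range_succ, add_sub_cancel_left, norm_mul, norm_pow]
      calc ‖(c N : ℚ_[p])‖ * ‖lam‖ ^ N ≤ 1 * r ^ N :=
            mul_le_mul (by exact_mod_cast Padic.norm_int_le_one (c N : ℤ)) (pow_le_pow_left₀ (norm_nonneg _) hlamn N)
              (pow_nonneg (norm_nonneg _) _) zero_le_one
        _ ≤ r ^ (N / 2) := by rw [one_mul]; exact pow_le_pow_of_le_one hr0 hr1.le (Nat.div_le_self N 2))
  -- the estimate at depth `N`
  have hN : ∀ N, IsPadicInt (C ((p : ℚ_[p]) ^ k) * f - (∑ n ∈ Finset.range N, (c n : ℚ_[p]) * lam ^ n) • W.formalLog -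
      (T ^ N) (W.formalLog.subst ((Gs N).map PadicInt.Coe.ringHom))) := fun N ↦ by
    have h1 := hmain N
    rw [hG₀, hℓψ] at h1
    have h2 := isPadicInt_digitSum_geom c (E := fun n ↦ (T ^ n) W.formalLog) hε N
    beta_reduce at h2
    have e : C ((p : ℚ_[p]) ^ k) * f - (∑ n ∈ Finset.range N, (c n : ℚ_[p]) * lam ^ n) • W.formalLog -
        (T ^ N) (W.formalLog.subst ((Gs N).map PadicInt.Coe.ringHom)) =
        (C ((p : ℚ_[p]) ^ k) * f - ∑ n ∈ Finset.range N, (c n : ℚ_[p]) • (T ^ n) W.formalLog -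
          (T ^ N) (W.formalLog.subst ((Gs N).map PadicInt.Coe.ringHom))) +
        (∑ n ∈ Finset.range N, (c n : ℚ_[p]) • (T ^ n) W.formalLog -
          (∑ n ∈ Finset.range N, (c n : ℚ_[p]) * lam ^ n) • W.formalLog) := by
      abel
    rw [e]
    exact h1.add h2
  refine ⟨((p : ℚ_[p]) ^ k)⁻¹ * aI, k, fun D ↦ ?_⟩
  set M : ℝ := ‖coeff D W.formalLog‖ with hM
  have hM1 : 0 < M + 1 := by positivity
  obtain ⟨K, hK⟩ := exists_pow_lt_of_lt_one (inv_pos.mpr hM1) hr1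
  have hK1 : r ^ K * (M + 1) ≤ 1 := by
    have := mul_lt_mul_of_pos_right hK hM1
    rw [inv_mul_cancel₀ hM1.ne'] at this
    exact this.le
  set N : ℕ := 2 * (K + D) with hNdef
  have hND : D < p ^ N :=
    lt_of_lt_of_le (Nat.lt_pow_self hp.out.one_lt) (Nat.pow_le_pow_right hp.out.pos (by omega))
  have hrN : r ^ (N / 2) ≤ r ^ K := by
    rw [hNdef, Nat.mul_div_cancel_left _ two_pos]
    exact pow_le_pow_of_le_one hr0 hr1.le (by omega)
  have hpk : (p : ℚ_[p]) ^ k ≠ 0 := pow_ne_zero _ hp0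
  have htail : coeff D ((T ^ N) (W.formalLog.subst ((Gs N).map PadicInt.Coe.ringHom))) = 0 :=
    coeff_expand_pow_eq_zero (PowerSeries.constantCoeff_subst_eq_zero
      (constantCoeff_map_coe_and_toZMod (Gs N) (hGs0 N)).1 _ W.constantCoeff_formalLog) hND
  have e : (p : ℚ_[p]) ^ k * coeff D (f - C (((p : ℚ_[p]) ^ k)⁻¹ * aI) * W.formalLog) =
      coeff D (C ((p : ℚ_[p]) ^ k) * f - (∑ n ∈ Finset.range N, (c n : ℚ_[p]) * lam ^ n) • W.formalLog -
        (T ^ N) (W.formalLog.subst ((Gs N).map PadicInt.Coe.ringHom))) +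
      coeff D ((T ^ N) (W.formalLog.subst ((Gs N).map PadicInt.Coe.ringHom))) -
      (aI - ∑ n ∈ Finset.range N, (c n : ℚ_[p]) * lam ^ n) * coeff D W.formalLog := by
    simp only [map_sub, coeff_C_mul, PowerSeries.coeff_smul, smul_eq_mul]
    field_simp
    ring
  rw [e, htail, add_zero]
  refine norm_sub_le_one (isPadicInt_iff_coeff.mp (hN N) D) ?_
  rw [norm_mul]
  calc ‖aI - ∑ n ∈ Finset.range N, (c n : ℚ_[p]) * lam ^ n‖ * ‖coeff D W.formalLog‖ ≤ r ^ K * (M + 1) :=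
        mul_le_mul ((ha N).trans hrN) (by rw [hM]; linarith) (norm_nonneg _) (pow_nonneg hr0 _)
    _ ≤ 1 := hK1

/-! ## §4 H3 on every good fibre -/

/-- **H3 FOR EVERY GOOD FIBRE (Katz's rank ≤ 2 over `ℤ_p`, elementary).** For `V/ℤ_p` (`p` odd) with elliptic generic and
special fibres and every `f ∈ Xℚ_p⟦X⟧` whose `F_W`-coboundary has bounded denominators there are `a, b ∈ ℚ_p`, `d''` with
**`p^{d''}·(f − a·log_W − b·log_W(Xᵖ)) ∈ ℤ_p⟦X⟧`** (supersingular: `exists_sub_formalLog_sub_expand_bounded`; ordinary: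
`exists_sub_formalLog_bounded_of_ordinary` with `b = 0`). At `p = 3` this is the unrestricted binder H3 of
`KatzRankBaseChange.katz_dieudonne_rank_le_two_of_padicRankTwo`. [cite: Katz1981CrystallineDieudonne, Thm. 5.3.3] -/
theorem exists_sub_formalLog_sub_expand_bounded_all (hp2 : p ≠ 2)
    (f : ℚ_[p]⟦X⟧) (hf0 : constantCoeff f = 0)
    (hSK : ∃ d : ℕ, ∀ e, ‖(p : ℚ_[p]) ^ d * MvPowerSeries.coeff e
      (f.subst (V.map PadicInt.Coe.ringHom).formalGroupLaw - f.subst (MvPowerSeries.X 0 : MvPowerSeries (Fin 2) ℚ_[p]) -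
        f.subst (MvPowerSeries.X 1 : MvPowerSeries (Fin 2) ℚ_[p]))‖ ≤ 1) :
    ∃ (a b : ℚ_[p]) (d'' : ℕ), ∀ n, ‖(p : ℚ_[p]) ^ d'' * coeff n (f - C a * (V.map PadicInt.Coe.ringHom).formalLog -
      C b * expand p hp.out.ne_zero (V.map PadicInt.Coe.ringHom).formalLog)‖ ≤ 1 := by
  by_cases hss : (p : ℤ) ∣ Literature.NumberTheory.EllipticCurves.HasseManin.tr (V.map PadicInt.toZMod)
  · exact exists_sub_formalLog_sub_expand_bounded V hp2 hss f hf0 hSK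
  · obtain ⟨a', d'', h⟩ := exists_sub_formalLog_bounded_of_ordinary V hp2 hss f hf0 hSK
    exact ⟨a', 0, d'', fun n ↦ by rw [map_zero, zero_mul, sub_zero]; exact h n⟩

end Ordinary

end Summit.BirchSwinnertonDyer.BirchSwinnertonDyer.Theorems.SecondKindLog
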